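import Literature.Analysis.Fourier.FractalUncertaintyHarmonicBound
import Literature.Analysis.Fourier.FractalUncertaintyProp31Fourier
import Literature.Analysis.Fourier.FractalUncertaintyProp31Tools
import Literature.Analysis.Fourier.FractalUncertaintyFourierTools
import HarnessLib

/-!
# BD18 Lemma 3.3 ("the smaller step"), `L²` form for one shifted frequency window

Topic `Literature/Analysis/Fourier`. J. Bourgain, S. Dyatlov, *Spectral gaps without the pressure
condition*, Ann. of Math. 187 (2018), §3.3, Lemma 3.3 and its proof (see also Jin–Zhang,
arXiv:1710.00250, Lemma 15): the multiplier `ψ` of Lemma 3.1 (`|ψ̂| ≤ e^{-c₂θ(ξ)|ξ|}` on the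
fattened regular set `Z(2)`, `supp ψ ⊂ [-c₁/10, c₁/10]`) converts Fourier support in `Z` into the
exponential frequency decay required by Lemma 3.2 (`bourgainDyatlov2018_lemma_3_2`), after cutting
at the frequency threshold `K`. We prove the core inequality in the `g`-language of
`FractalUncertaintyPrinciple.lean`, for ONE function `w ∈ L¹ ∩ L²` vanishing off `Z(2)` (in the
paper `w = f̂_η = f̂(· - η)`), entirely in `L²` terms (the paper's `H^{-10}` norms are replaced by the
quantity `A = ∫_{U''} |ψ ⋆ (1_{U'} 𝓕⁻w)|²`, to be summed over the shifts in the proof of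
Proposition 3.1):

* `smaller_step` — with `θK = θ(K)`, `r = c₂θK/10`, `κ = e^{-C/r}` (`C` the constant of Lemma 3.2
  for `c₀ = c₁/2`) and `ε = e^{-c₂θK K}`,
  `∫ |ψ̂ w|² ≤ (C/r)(2A + 2ε‖w‖²)^κ ‖w‖^{2(1-κ)} + ε‖w‖²`.

The steps are the paper's: `ĝ = ψ̂w = ĝ₁ + ĝ₂` (frequencies `≤ K` / `> K`), `‖ĝ₂‖² ≤ ε‖w‖²` by the
decay on `Z(2)` and the growth of `θ(ξ)|ξ|` (`theta_mul_growth`), `‖e^{2πr|ξ|}ĝ₁‖ ≤ ‖w‖` by the choice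
of `r` (`theta_antitone`), Lemma 3.2 for `𝓕⁻ĝ₁`, and on `U''` the locality `ψ ⋆ 𝓕⁻w = ψ ⋆ (1_{U'}𝓕⁻w)`
(`convolution_congr_local`). No definitions are introduced.
-/

namespace Literature.Analysis.Fourier

open _root_.MeasureTheory Set Filter
open scoped FourierTransform Real Topology ENNReal Convolution

section SmallerStep

set_option maxHeartbeats 800000 in
/-- **BD18 Lemma 3.3, core `L²` inequality.** Let `0 < c₁`, `0 < c₂ ≤ 1`, `0 < δ < 1`, and let
`C > 0` satisfy the conclusion of Lemma 3.2 for `c₀ = c₁/2`. Let `t_j` be centres with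
`[t_j - c₁/2, t_j + c₁/2] ⊂ [j, j+1]`, `U' = ⋃_j [t_j - c₁/2, t_j + c₁/2]`,
`U'' = ⋃_j [t_j - c₁/4, t_j + c₁/4]`. Let `ψ ∈ L¹` vanish for `|x| > c₁/10` with
`|ψ̂| ≤ e^{-c₂⟨ξ⟩^{1/2}}` on `ℝ` and `|ψ̂(ξ)| ≤ e^{-c₂θ(ξ)|ξ|}` on a set `Z₂`, and let `w ∈ L¹ ∩ L²`
vanish off `Z₂`. Then for `K ≥ 10`, `θK = log(10+K)^{-(1+δ)/2}`, `r = c₂θK/10`, `κ = e^{-C/r}`,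
`ε = e^{-c₂θK K}` and `A = ∫_{U''} |(ψ ⋆ 1_{U'}𝓕⁻w)(x)|² dx`:
`∫ |ψ̂(ξ)w(ξ)|² dξ ≤ (C/r)(2A + 2ε‖w‖²)^κ (‖w‖²)^{1-κ} + ε‖w‖²`.
[cite: BourgainDyatlov2018, Lemma 3.3 (proof)] -/
theorem smaller_step {c₁ c₂ δ C : ℝ} (hc₁ : 0 < c₁) (hc₂ : 0 < c₂) (hc₂1 : c₂ ≤ 1)
    (hδ0 : 0 < δ) (hδ1 : δ < 1) (hC : 0 < C)
    (hL32 : ∀ r : ℝ, 0 < r → r < 1 → ∀ κ : ℝ, 0 < κ → κ ≤ Real.exp (-C / r) →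
      ∀ b : ℤ → ℝ, (∀ j : ℤ, (j : ℝ) ≤ b j ∧ b j + c₁ / 2 ≤ j + 1) →
      ∀ g : ℝ → ℂ, MemLp g 2 volume → (∃ R : ℝ, ∀ ξ, R < |ξ| → g ξ = 0) →
        ∫ x, ‖(𝓕⁻ g : ℝ → ℂ) x‖ ^ 2 ≤
          C / r * (∫ x in ⋃ j : ℤ, Icc (b j) (b j + c₁ / 2), ‖(𝓕⁻ g : ℝ → ℂ) x‖ ^ 2) ^ κ *
            (∫ ξ, Real.exp (4 * π * r * |ξ|) * ‖g ξ‖ ^ 2) ^ (1 - κ))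
    (t : ℤ → ℝ) (ht : ∀ j : ℤ, Icc (t j - c₁ / 2) (t j + c₁ / 2) ⊆ Icc (j : ℝ) ((j : ℝ) + 1))
    (ψ : ℝ → ℂ) (hψi : Integrable ψ) (hψsupp : ∀ x, c₁ / 10 < |x| → ψ x = 0)
    (hψdec : ∀ ξ, ‖𝓕 ψ ξ‖ ≤ Real.exp (-(c₂ * (1 + ξ ^ 2) ^ (1 / 4 : ℝ))))
    (Z₂ : Set ℝ)
    (hψZ : ∀ ξ ∈ Z₂, ‖𝓕 ψ ξ‖ ≤ Real.exp (-(c₂ * (Real.log (10 + |ξ|) ^ (-(1 + δ) / 2) * |ξ|))))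
    (w : ℝ → ℂ) (hwi : Integrable w) (hw2 : MemLp w 2 volume) (hwZ : ∀ ξ, ξ ∉ Z₂ → w ξ = 0)
    {K : ℝ} (hK : 10 ≤ K) (θK r κ ε A : ℝ)
    (hθK : θK = Real.log (10 + K) ^ (-(1 + δ) / 2)) (hr : r = c₂ * θK / 10)
    (hκ : κ = Real.exp (-C / r)) (hε : ε = Real.exp (-(c₂ * θK * K)))
    (hA : A = ∫ x in ⋃ j : ℤ, Icc (t j - c₁ / 4) (t j + c₁ / 4),
      ‖(ψ ⋆[ContinuousLinearMap.mul ℂ ℂ, volume]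
        ((⋃ j : ℤ, Icc (t j - c₁ / 2) (t j + c₁ / 2)).indicator (𝓕⁻ w : ℝ → ℂ))) x‖ ^ 2) :
    ∫ ξ, ‖𝓕 ψ ξ * w ξ‖ ^ 2 ≤
      C / r * (2 * A + 2 * ε * ∫ ξ, ‖w ξ‖ ^ 2) ^ κ * (∫ ξ, ‖w ξ‖ ^ 2) ^ (1 - κ) +
        ε * ∫ ξ, ‖w ξ‖ ^ 2 := by
  have hπ := Real.pi_pos
  -- unpack the constants
  set p : ℝ := (1 + δ) / 2 with hp
  have hp0 : 0 ≤ p := by rw [hp]; linarith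
  have hp1 : p ≤ 1 := by rw [hp]; linarith
  have hθK' : θK = Real.log (10 + K) ^ (-p) := by rw [hθK, hp]; ring_nf
  have hK0 : 0 ≤ K := by linarith
  have hK1 : 1 ≤ K := by linarith
  have hθK0 : 0 < θK := by rw [hθK']; exact Prop31.theta_pos p hK0
  have hθK1 : θK ≤ 1 := by rw [hθK']; exact Prop31.theta_le_one hp0 hK0
  have hr0 : 0 < r := by rw [hr]; positivity
  have hr1 : r < 1 := by
    rw [hr]; have : c₂ * θK ≤ 1 := by nlinarith
    linarith
  have hκ0 : 0 < κ := by rw [hκ]; exact Real.exp_pos _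
  have hκ1 : κ < 1 := by
    rw [hκ, Real.exp_lt_one_iff, neg_div]; exact neg_neg_of_pos (div_pos hC hr0)
  have hε0 : 0 < ε := by rw [hε]; exact Real.exp_pos _
  -- `ψ̂` is continuous and bounded by `1`
  have hFψc : Continuous (𝓕 ψ) := Literature.Analysis.FunctionSpaces.continuous_fourierIntegral hψi
  have hFψ1 : ∀ ξ, ‖𝓕 ψ ξ‖ ≤ 1 := fun ξ =>
    (hψdec ξ).trans (Real.exp_le_one_iff.2 (by
      have : 0 ≤ (1 + ξ ^ 2) ^ (1 / 4 : ℝ) := Real.rpow_nonneg (by positivity) _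
      nlinarith))
  -- `ĝ = ψ̂ w` and its two pieces
  set gh : ℝ → ℂ := fun ξ => 𝓕 ψ ξ * w ξ with hgh
  set S : Set ℝ := Icc (-K) K with hS
  have hSm : MeasurableSet S := measurableSet_Icc
  set g₁ : ℝ → ℂ := S.indicator gh with hg₁
  set g₂ : ℝ → ℂ := Sᶜ.indicator gh with hg₂
  have hgh_meas : AEStronglyMeasurable gh volume := hFψc.aestronglyMeasurable.mul hw2.1
  have hgh_le : ∀ ξ, ‖gh ξ‖ ≤ ‖w ξ‖ := fun ξ => by
    rw [hgh]; simp only [norm_mul]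
    exact mul_le_of_le_one_left (norm_nonneg _) (hFψ1 ξ)
  have hgh_int : Integrable gh := hwi.mono hgh_meas (Eventually.of_forall hgh_le)
  have hgh_L2 : MemLp gh 2 volume := by
    refine (memLp_two_iff_integrable_sq_norm hgh_meas).2 ?_
    have hw := (memLp_two_iff_integrable_sq_norm hw2.1).1 hw2
    refine hw.mono' (hgh_meas.norm.pow 2) (Eventually.of_forall fun ξ => ?_)
    rw [Real.norm_eq_abs, abs_of_nonneg (by positivity)]
    exact pow_le_pow_left₀ (norm_nonneg _) (hgh_le ξ) 2
  have hg₁_int : Integrable g₁ := hgh_int.indicator hSm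
  have hg₂_int : Integrable g₂ := hgh_int.indicator hSm.compl
  have hg₁_L2 : MemLp g₁ 2 volume := hgh_L2.indicator hSm
  have hg₂_L2 : MemLp g₂ 2 volume := hgh_L2.indicator hSm.compl
  have hsplit : ∀ ξ, gh ξ = g₁ ξ + g₂ ξ := fun ξ => by
    rw [hg₁, hg₂]; exact (Set.indicator_self_add_compl_apply S gh ξ).symm
  have hsq_split : ∀ ξ, ‖gh ξ‖ ^ 2 = ‖g₁ ξ‖ ^ 2 + ‖g₂ ξ‖ ^ 2 := by
    intro ξ
    rw [hg₁, hg₂]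
    by_cases hξ : ξ ∈ S
    · rw [indicator_of_mem hξ, indicator_of_notMem (notMem_compl_iff.2 hξ), norm_zero]; ring
    · rw [indicator_of_notMem hξ, indicator_of_mem (mem_compl hξ), norm_zero]; ring
  have hw_sq : Integrable (fun ξ => ‖w ξ‖ ^ 2) := (memLp_two_iff_integrable_sq_norm hw2.1).1 hw2
  have hg₁_sq : Integrable (fun ξ => ‖g₁ ξ‖ ^ 2) := (memLp_two_iff_integrable_sq_norm hg₁_L2.1).1 hg₁_L2
  have hg₂_sq : Integrable (fun ξ => ‖g₂ ξ‖ ^ 2) := (memLp_two_iff_integrable_sq_norm hg₂_L2.1).1 hg₂_L2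
  set W : ℝ := (∫ ξ, ‖w ξ‖ ^ 2) with hWdef
  have hW0 : 0 ≤ W := integral_nonneg fun ξ => by positivity
  -- (1) the high-frequency piece: `‖ĝ₂(ξ)‖² ≤ ε ‖w(ξ)‖²`
  have hhigh_pt : ∀ ξ, ‖g₂ ξ‖ ^ 2 ≤ ε * ‖w ξ‖ ^ 2 := by
    intro ξ
    rw [hg₂]
    by_cases hξ : ξ ∈ S
    · rw [indicator_of_notMem (notMem_compl_iff.2 hξ), norm_zero, zero_pow two_ne_zero]; positivity
    · rw [indicator_of_mem (mem_compl hξ), hgh]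
      simp only [norm_mul, mul_pow]
      by_cases hZ : ξ ∈ Z₂
      · have hKξ : K ≤ |ξ| := by
          rw [hS, mem_Icc, not_and_or, not_le, not_le] at hξ
          rcases hξ with h | h
          · rw [abs_of_neg (by linarith)]; linarith
          · rw [abs_of_pos (by linarith)]; linarith
        have h1 := hψZ ξ hZ
        -- `2 θ(ξ)|ξ| ≥ θ(K) √K √|ξ| ≥ θ(K) K`
        have hgrow := Prop31.theta_mul_growth (p := p) hp1 hK1 hKξ
        have hsqrt : K ≤ Real.sqrt K * Real.sqrt |ξ| := by
          rw [← Real.sqrt_mul hK0]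
          calc K = Real.sqrt (K * K) := by rw [Real.sqrt_mul_self hK0]
            _ ≤ Real.sqrt (K * |ξ|) := Real.sqrt_le_sqrt (by nlinarith)
        have h2 : θK * K ≤ 2 * (Real.log (10 + |ξ|) ^ (-p) * |ξ|) := by
          rw [hθK']
          calc Real.log (10 + K) ^ (-p) * K ≤ Real.log (10 + K) ^ (-p) * (Real.sqrt K * Real.sqrt |ξ|) :=
                mul_le_mul_of_nonneg_left hsqrt (Prop31.theta_pos p hK0).le
            _ = Real.log (10 + K) ^ (-p) * Real.sqrt K * Real.sqrt |ξ| := by ring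
            _ ≤ 2 * (Real.log (10 + |ξ|) ^ (-p) * |ξ|) := hgrow
        have h3 : ‖𝓕 ψ ξ‖ ^ 2 ≤ ε := by
          have h4 : ‖𝓕 ψ ξ‖ ^ 2 ≤ Real.exp (-(c₂ * (Real.log (10 + |ξ|) ^ (-(1 + δ) / 2) * |ξ|))) ^ 2 :=
            pow_le_pow_left₀ (norm_nonneg _) h1 2
          refine h4.trans ?_
          rw [← Real.exp_nat_mul, hε, Real.exp_le_exp]
          push_cast
          rw [show -(1 + δ) / 2 = -p by rw [hp]; ring]
          nlinarith [hc₂]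
        exact mul_le_mul_of_nonneg_right h3 (by positivity)
      · rw [hwZ ξ hZ, norm_zero]; simp
  have hhigh : ∫ ξ, ‖g₂ ξ‖ ^ 2 ≤ ε * W := by
    rw [hWdef, ← integral_const_mul]
    exact integral_mono hg₂_sq (hw_sq.const_mul ε) hhigh_pt
  -- (2) the low-frequency piece has controlled exponential growth
  have hlow_pt : ∀ ξ, Real.exp (4 * π * r * |ξ|) * ‖g₁ ξ‖ ^ 2 ≤ ‖w ξ‖ ^ 2 := by
    intro ξ
    rw [hg₁]
    by_cases hξ : ξ ∈ S
    · rw [indicator_of_mem hξ, hgh]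
      simp only [norm_mul, mul_pow]
      by_cases hZ : ξ ∈ Z₂
      · have hξK : |ξ| ≤ K := abs_le.2 ⟨by linarith [hξ.1], hξ.2⟩
        have h1 := hψZ ξ hZ
        have hanti := Prop31.theta_antitone (p := p) hp0 (abs_nonneg ξ) hξK
        -- `4πr|ξ| ≤ 2 c₂ θ(ξ) |ξ|`
        have h2 : 4 * π * r * |ξ| ≤ 2 * (c₂ * (Real.log (10 + |ξ|) ^ (-p) * |ξ|)) := by
          rw [hr, hθK']
          have hπ4 : π ≤ 4 := Real.pi_le_four
          have : 4 * π * (c₂ * Real.log (10 + K) ^ (-p) / 10) ≤ 2 * c₂ * Real.log (10 + |ξ|) ^ (-p) := by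
            have h3 : 0 ≤ c₂ * Real.log (10 + K) ^ (-p) :=
              (mul_pos hc₂ (Prop31.theta_pos p hK0)).le
            nlinarith [mul_le_mul_of_nonneg_left hanti hc₂.le]
          nlinarith [abs_nonneg ξ]
        have h3 : Real.exp (4 * π * r * |ξ|) * ‖𝓕 ψ ξ‖ ^ 2 ≤ 1 := by
          have h4 : ‖𝓕 ψ ξ‖ ^ 2 ≤ Real.exp (-(c₂ * (Real.log (10 + |ξ|) ^ (-(1 + δ) / 2) * |ξ|))) ^ 2 :=
            pow_le_pow_left₀ (norm_nonneg _) h1 2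
          calc Real.exp (4 * π * r * |ξ|) * ‖𝓕 ψ ξ‖ ^ 2
              ≤ Real.exp (4 * π * r * |ξ|) * Real.exp (-(c₂ * (Real.log (10 + |ξ|) ^ (-(1 + δ) / 2) * |ξ|))) ^ 2 :=
                mul_le_mul_of_nonneg_left h4 (Real.exp_pos _).le
            _ = Real.exp (4 * π * r * |ξ| - 2 * (c₂ * (Real.log (10 + |ξ|) ^ (-p) * |ξ|))) := by
                rw [← Real.exp_nat_mul, ← Real.exp_add]; congr 1; push_cast
                rw [show -(1 + δ) / 2 = -p by rw [hp]; ring]; ring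
            _ ≤ 1 := by rw [Real.exp_le_one_iff]; linarith
        calc Real.exp (4 * π * r * |ξ|) * (‖𝓕 ψ ξ‖ ^ 2 * ‖w ξ‖ ^ 2)
            = (Real.exp (4 * π * r * |ξ|) * ‖𝓕 ψ ξ‖ ^ 2) * ‖w ξ‖ ^ 2 := by ring
          _ ≤ 1 * ‖w ξ‖ ^ 2 := mul_le_mul_of_nonneg_right h3 (by positivity)
          _ = ‖w ξ‖ ^ 2 := one_mul _
      · rw [hwZ ξ hZ, norm_zero]; simp
    · rw [indicator_of_notMem hξ, norm_zero]; simp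
  have hlow_int : Integrable fun ξ => Real.exp (4 * π * r * |ξ|) * ‖g₁ ξ‖ ^ 2 := by
    refine hw_sq.mono' ?_ (Eventually.of_forall fun ξ => ?_)
    · exact ((by fun_prop : Continuous fun ξ => Real.exp (4 * π * r * |ξ|)).aestronglyMeasurable).mul
        (hg₁_L2.1.norm.pow 2)
    · rw [Real.norm_eq_abs, abs_of_nonneg (by positivity)]; exact hlow_pt ξ
  have hlow : ∫ ξ, Real.exp (4 * π * r * |ξ|) * ‖g₁ ξ‖ ^ 2 ≤ W := integral_mono hlow_int hw_sq hlow_pt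
  have hlow0 : 0 ≤ ∫ ξ, Real.exp (4 * π * r * |ξ|) * ‖g₁ ξ‖ ^ 2 := integral_nonneg fun ξ => by positivity
  -- (3) Lemma 3.2 for `𝓕⁻ ĝ₁`
  set b : ℤ → ℝ := fun j => t j - c₁ / 4 with hb
  have hbj : ∀ j : ℤ, (j : ℝ) ≤ b j ∧ b j + c₁ / 2 ≤ j + 1 := by
    intro j
    have h1 := ht j
    have hl : t j - c₁ / 2 ∈ Icc (t j - c₁ / 2) (t j + c₁ / 2) := ⟨le_rfl, by linarith⟩
    have hu : t j + c₁ / 2 ∈ Icc (t j - c₁ / 2) (t j + c₁ / 2) := ⟨by linarith, le_rfl⟩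
    have := h1 hl; have := h1 hu
    simp only [mem_Icc] at *
    constructor <;> simp only [hb] <;> linarith
  have hU''eq : (⋃ j : ℤ, Icc (b j) (b j + c₁ / 2)) = ⋃ j : ℤ, Icc (t j - c₁ / 4) (t j + c₁ / 4) := by
    congr 1; funext j; simp only [hb]; congr 1; ring
  have hg₁supp : ∃ R : ℝ, ∀ ξ, R < |ξ| → g₁ ξ = 0 := by
    refine ⟨K, fun ξ hξ => ?_⟩
    rw [hg₁]; refine indicator_of_notMem ?_ _
    rw [hS, mem_Icc, not_and_or, not_le, not_le]
    rcases lt_or_ge ξ 0 with h | h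
    · rw [abs_of_neg h] at hξ; left; linarith
    · rw [abs_of_nonneg h] at hξ; right; linarith
  have h32 := hL32 r hr0 hr1 κ hκ0 (by rw [hκ]) b hbj g₁ hg₁_L2 hg₁supp
  rw [hU''eq] at h32
  -- Plancherel for the pieces
  have hP₁ : ∫ x, ‖(𝓕⁻ g₁ : ℝ → ℂ) x‖ ^ 2 = ∫ ξ, ‖g₁ ξ‖ ^ 2 := integral_norm_sq_fourierInv_eq hg₁_int hg₁_L2
  have hP₂ : ∫ x, ‖(𝓕⁻ g₂ : ℝ → ℂ) x‖ ^ 2 = ∫ ξ, ‖g₂ ξ‖ ^ 2 := integral_norm_sq_fourierInv_eq hg₂_int hg₂_L2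
  have hPg : ∫ x, ‖(𝓕⁻ gh : ℝ → ℂ) x‖ ^ 2 = ∫ ξ, ‖gh ξ‖ ^ 2 := integral_norm_sq_fourierInv_eq hgh_int hgh_L2
  -- (4) the window term: `∫_{U''} |𝓕⁻ĝ₁|² ≤ 2A + 2 ‖ĝ₂‖²`
  set U'' : Set ℝ := (⋃ j : ℤ, Icc (t j - c₁ / 4) (t j + c₁ / 4)) with hU''
  set U' : Set ℝ := (⋃ j : ℤ, Icc (t j - c₁ / 2) (t j + c₁ / 2)) with hU'
  have hU''m : MeasurableSet U'' := MeasurableSet.iUnion fun j => measurableSet_Icc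
  have hU'm : MeasurableSet U' := MeasurableSet.iUnion fun j => measurableSet_Icc
  -- `𝓕⁻ ĝ = ψ ⋆ 𝓕⁻ w = ψ ⋆ (1_{U'} 𝓕⁻ w)` on `U''`
  have hconv : ∀ x, (𝓕⁻ gh : ℝ → ℂ) x = (ψ ⋆[ContinuousLinearMap.mul ℂ ℂ, volume] (𝓕⁻ w : ℝ → ℂ)) x :=
    fun x => (Prop31.convolution_fourierInv_eq hψi hwi x).symm
  have hψsupp' : ∀ y, y ∉ Icc (-(c₁ / 10)) (c₁ / 10) → ψ y = 0 := by
    intro y hy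
    refine hψsupp y ?_
    rw [mem_Icc, not_and_or, not_le, not_le] at hy
    rcases hy with h | h
    · rw [abs_of_neg (by linarith)]; linarith
    · rw [abs_of_pos (by linarith)]; linarith
  have hlocal : ∀ x ∈ U'', (ψ ⋆[ContinuousLinearMap.mul ℂ ℂ, volume] (𝓕⁻ w : ℝ → ℂ)) x =
      (ψ ⋆[ContinuousLinearMap.mul ℂ ℂ, volume] (U'.indicator (𝓕⁻ w : ℝ → ℂ))) x := by
    intro x hx
    refine Prop31.convolution_congr_local (ρ := c₁ / 10) hψsupp' fun y hy => ?_
    rw [indicator_of_mem]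
    rw [hU''] at hx
    obtain ⟨j, hj⟩ := mem_iUnion.1 hx
    rw [hU']
    refine mem_iUnion.2 ⟨j, ?_⟩
    simp only [mem_Icc] at hj hy ⊢
    constructor <;> linarith [hj.1, hj.2, hy.1, hy.2]
  have hA' : ∫ x in U'', ‖(𝓕⁻ gh : ℝ → ℂ) x‖ ^ 2 = A := by
    rw [hA]
    refine setIntegral_congr_fun hU''m fun x hx => ?_
    rw [hconv x, hlocal x hx]
  have hA0 : 0 ≤ A := by rw [← hA']; exact integral_nonneg fun x => by positivity
  -- integrability of the squares of the inverse transforms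
  have hF₁ : Integrable (fun x => ‖(𝓕⁻ g₁ : ℝ → ℂ) x‖ ^ 2) := integrable_norm_sq_fourierInv hg₁_int hg₁_L2
  have hF₂ : Integrable (fun x => ‖(𝓕⁻ g₂ : ℝ → ℂ) x‖ ^ 2) := integrable_norm_sq_fourierInv hg₂_int hg₂_L2
  have hFg : Integrable (fun x => ‖(𝓕⁻ gh : ℝ → ℂ) x‖ ^ 2) := integrable_norm_sq_fourierInv hgh_int hgh_L2
  have hfun : gh = g₁ + g₂ := funext fun ξ => by rw [Pi.add_apply]; exact hsplit ξ
  have hadd := VectorFourier.fourierIntegral_add (μ := (volume : Measure ℝ)) (L := -innerₗ ℝ)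
    Real.continuous_fourierChar (by exact continuous_inner.neg) hg₁_int hg₂_int
  have hlin : ∀ x, (𝓕⁻ g₁ : ℝ → ℂ) x = (𝓕⁻ gh : ℝ → ℂ) x - (𝓕⁻ g₂ : ℝ → ℂ) x := by
    intro x
    have h1 : (𝓕⁻ gh : ℝ → ℂ) x = (𝓕⁻ g₁ : ℝ → ℂ) x + (𝓕⁻ g₂ : ℝ → ℂ) x := by
      rw [hfun]; exact congrFun hadd x
    rw [h1]; ring
  have hwindow : ∫ x in U'', ‖(𝓕⁻ g₁ : ℝ → ℂ) x‖ ^ 2 ≤ 2 * A + 2 * (∫ ξ, ‖g₂ ξ‖ ^ 2) := by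
    calc ∫ x in U'', ‖(𝓕⁻ g₁ : ℝ → ℂ) x‖ ^ 2
        ≤ ∫ x in U'', (2 * ‖(𝓕⁻ gh : ℝ → ℂ) x‖ ^ 2 + 2 * ‖(𝓕⁻ g₂ : ℝ → ℂ) x‖ ^ 2) := by
          refine setIntegral_mono_on hF₁.integrableOn ((hFg.const_mul 2).add (hF₂.const_mul 2)).integrableOn
            hU''m fun x _ => ?_
          rw [hlin x]
          set a : ℂ := (𝓕⁻ gh : ℝ → ℂ) x
          set a' : ℂ := (𝓕⁻ g₂ : ℝ → ℂ) x
          have h := norm_sub_le a a'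
          nlinarith [norm_nonneg (a - a'), norm_nonneg a, norm_nonneg a', sq_nonneg (‖a‖ - ‖a'‖)]
      _ = 2 * (∫ x in U'', ‖(𝓕⁻ gh : ℝ → ℂ) x‖ ^ 2) + 2 * (∫ x in U'', ‖(𝓕⁻ g₂ : ℝ → ℂ) x‖ ^ 2) := by
          rw [integral_add (hFg.const_mul 2).integrableOn (hF₂.const_mul 2).integrableOn,
            integral_const_mul, integral_const_mul]
      _ ≤ 2 * A + 2 * (∫ ξ, ‖g₂ ξ‖ ^ 2) := by
          rw [hA', ← hP₂]
          have h5 := setIntegral_le_integral (s := U'') hF₂ (ae_of_all _ fun x => by positivity)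
          linarith
  -- (5) assemble
  have hwin0 : 0 ≤ ∫ x in U'', ‖(𝓕⁻ g₁ : ℝ → ℂ) x‖ ^ 2 := integral_nonneg fun x => by positivity
  have h32' : ∫ ξ, ‖g₁ ξ‖ ^ 2 ≤ C / r * (2 * A + 2 * ε * W) ^ κ * W ^ (1 - κ) := by
    rw [← hP₁]
    refine h32.trans ?_
    have h1 : (∫ x in U'', ‖(𝓕⁻ g₁ : ℝ → ℂ) x‖ ^ 2) ^ κ ≤ (2 * A + 2 * ε * W) ^ κ := by
      refine Real.rpow_le_rpow hwin0 (hwindow.trans ?_) hκ0.le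
      nlinarith [hhigh]
    have h2 : (∫ ξ, Real.exp (4 * π * r * |ξ|) * ‖g₁ ξ‖ ^ 2) ^ (1 - κ) ≤ W ^ (1 - κ) :=
      Real.rpow_le_rpow hlow0 hlow (by linarith)
    have h3 : 0 ≤ C / r := by positivity
    exact mul_le_mul (mul_le_mul_of_nonneg_left h1 h3) h2 (by positivity) (by positivity)
  calc ∫ ξ, ‖𝓕 ψ ξ * w ξ‖ ^ 2 = ∫ ξ, (‖g₁ ξ‖ ^ 2 + ‖g₂ ξ‖ ^ 2) := by
        refine integral_congr_ae (ae_of_all _ fun ξ => ?_)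
        exact hsq_split ξ
    _ = (∫ ξ, ‖g₁ ξ‖ ^ 2) + (∫ ξ, ‖g₂ ξ‖ ^ 2) := integral_add hg₁_sq hg₂_sq
    _ ≤ C / r * (2 * A + 2 * ε * W) ^ κ * W ^ (1 - κ) + ε * W := add_le_add h32' hhigh

end SmallerStep

end Literature.Analysis.Fourier
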